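import Mathlib
import HarnessLib

/-!
# Helper (pure real algebra) toward stub `stub_coreInverse` of the line `braid-closed-large-circulation-gluing`
# (crux stmt-AnomalousDissipation-3009, `MarginalStabilityChain.StretchedVortexRows`): the Schur absorption step

The energy method for the cut-off core operator produces two inequalities between the nonnegative quantities
`E` (Dirichlet energy `∫G|∇u|²`), `Z = E + N` (`N = ‖w‖²_X`), `T = Θ^{1/2}` (angular energy), `φ = ‖f‖` (data) and `a = |α|`
(circulation): the pairing with `w`,
  `E ≤ φ z + B′ z T`            (`z = Z^{1/2}`; strain and background cross terms of size `B′`),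
and the pairing with `∂_θw` (rotation coercivity `0.35 a Θ` on the left),
  `(7/20) a T² ≤ 4 φ z + 4 A′ z T`.
Together with the gap `Z ≤ 3E` they close, for `138 A′B′ ≤ a` and `B′² ≤ a`, into `Z ≤ 92500 φ²`
(`coreInverse_absorb`): two Young inequalities and bookkeeping. `coreInverse_params` checks that the side conditions follow
from `R ≤ a^{1/12}` and `a ≥ R₀(β, C₃, C₄)` with `A′ = 80βR² + C₄`, `B′ = 40βR³ + C₃`.
-/

set_option linter.dupNamespace false

noncomputable section

namespace Summit.AnomalousDissipation.AnomalousDissipation.Theorems.MarginalStabilityChainStretchedVortexRows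

/-- **Schur absorption** (pure algebra of the energy method for `stub_coreInverse`). [folklore] -/
theorem coreInverse_absorb : ∀ (E Z T z φ a A' B' : ℝ) (hz : 0 ≤ z) (hφ : 0 ≤ φ) (ha : 0 < a)
    (hA : 0 ≤ A') (hB : 0 ≤ B') (hzZ : z ^ 2 = Z) (hgap : Z ≤ 3 * E)
    (hP1 : E ≤ φ * z + B' * z * T) (hP2 : 7 / 20 * a * T ^ 2 ≤ 4 * φ * z + 4 * A' * z * T)
    (hAB : 138 * (A' * B') ≤ a) (hBa : B' ^ 2 ≤ a),
    Z ≤ 92500 * φ ^ 2 := by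
  intro E Z T z φ a A' B' hz hφ ha hA hB hzZ hgap hP1 hP2 hAB hBa
  -- Step 1: absorb the `A' z T` term in (P2):  (7/40) a T² ≤ 4 φ z + (4A'z)²/(0.7 a)
  have h1 : 4 * A' * z * T ≤ 7 / 40 * a * T ^ 2 + (4 * A' * z) ^ 2 / (7 / 10 * a) := by
    have hden : 0 < 7 / 10 * a := by positivity
    rw [← sub_nonneg]
    have key : 7 / 40 * a * T ^ 2 + (4 * A' * z) ^ 2 / (7 / 10 * a) - 4 * A' * z * T =
        (7 / 40 * a) * (T - 4 * A' * z / (7 / 20 * a)) ^ 2 := by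
      field_simp
      ring
    rw [key]
    positivity
  have hT2 : T ^ 2 ≤ 160 / 7 * (φ * z) / a + 6400 / 49 * (A' ^ 2 * Z) / a ^ 2 := by
    have h2 : 7 / 40 * a * T ^ 2 ≤ 4 * φ * z + (4 * A' * z) ^ 2 / (7 / 10 * a) := by linarith
    have h3 : T ^ 2 ≤ (4 * φ * z + (4 * A' * z) ^ 2 / (7 / 10 * a)) / (7 / 40 * a) := by
      rw [le_div_iff₀ (by positivity)]; linarith
    calc T ^ 2 ≤ (4 * φ * z + (4 * A' * z) ^ 2 / (7 / 10 * a)) / (7 / 40 * a) := h3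
      _ = 160 / 7 * (φ * z) / a + 6400 / 49 * (A' ^ 2 * Z) / a ^ 2 := by
        rw [← hzZ]; field_simp; ring
  -- Step 2: Young in (P1): B' z T ≤ B'² Z/(4μ) + μ T² with μ = 3 B'² — unless B' = 0
  have hE : E ≤ φ * z + Z / 12 + 3 * B' ^ 2 * T ^ 2 := by
    have hy : B' * z * T ≤ Z / 12 + 3 * B' ^ 2 * T ^ 2 := by
      rw [← hzZ]
      nlinarith [sq_nonneg (z - 6 * B' * T), sq_nonneg z]
    linarith
  -- Step 3: combine
  have hφz : 0 ≤ φ * z := mul_nonneg hφ hz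
  have hZ0 : 0 ≤ Z := by rw [← hzZ]; positivity
  have hB2T2 : B' ^ 2 * T ^ 2 ≤ 160 / 7 * (φ * z) + 6400 / 49 * (A' ^ 2 * B' ^ 2 * Z) / a ^ 2 := by
    have := mul_le_mul_of_nonneg_left hT2 (sq_nonneg B')
    have e1 : B' ^ 2 * (160 / 7 * (φ * z) / a) ≤ 160 / 7 * (φ * z) := by
      rw [show B' ^ 2 * (160 / 7 * (φ * z) / a) = (B' ^ 2 / a) * (160 / 7 * (φ * z)) by ring]
      have : B' ^ 2 / a ≤ 1 := by rw [div_le_one ha]; exact hBa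
      nlinarith
    have e2 : B' ^ 2 * (6400 / 49 * (A' ^ 2 * Z) / a ^ 2) = 6400 / 49 * (A' ^ 2 * B' ^ 2 * Z) / a ^ 2 := by
      ring
    nlinarith
  have hAB2 : A' ^ 2 * B' ^ 2 / a ^ 2 ≤ 1 / 138 ^ 2 := by
    have hABnn : 0 ≤ A' * B' := mul_nonneg hA hB
    have : (A' * B') / a ≤ 1 / 138 := by
      rw [div_le_div_iff₀ ha (by norm_num)]; linarith
    have h' : (A' * B' / a) ^ 2 ≤ (1 / 138) ^ 2 := pow_le_pow_left₀ (by positivity) this 2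
    calc A' ^ 2 * B' ^ 2 / a ^ 2 = (A' * B' / a) ^ 2 := by ring
      _ ≤ (1 / 138) ^ 2 := h'
      _ = 1 / 138 ^ 2 := by norm_num
  have hZ1 : Z ≤ 3 * (φ * z) + Z / 4 + 9 * (160 / 7 * (φ * z) + 6400 / 49 * (A' ^ 2 * B' ^ 2 * Z) / a ^ 2) := by
    nlinarith
  have hcross : 6400 / 49 * (A' ^ 2 * B' ^ 2 * Z) / a ^ 2 ≤ 6400 / 49 / 138 ^ 2 * Z := by
    have : 6400 / 49 * (A' ^ 2 * B' ^ 2 * Z) / a ^ 2 = 6400 / 49 * (A' ^ 2 * B' ^ 2 / a ^ 2) * Z := by ring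
    rw [this]
    nlinarith
  -- `Z (1 − 1/4 − 9·6400/(49·138²)) ≤ (3 + 9·160/7) φ z`, i.e. `0.688 Z ≤ 208.8 φ z`
  have hZ2 : 11 / 16 * Z ≤ 209 * (φ * z) := by nlinarith
  -- `z ≤ 304 φ`, `Z ≤ 304² φ²`
  have hz304 : z ≤ 304 * φ := by
    rw [← hzZ] at hZ2
    by_contra hcon
    push Not at hcon
    nlinarith
  calc Z = z ^ 2 := hzZ.symm
    _ ≤ (304 * φ) ^ 2 := pow_le_pow_left₀ hz hz304 2
    _ = 92416 * φ ^ 2 := by ring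
    _ ≤ 92500 * φ ^ 2 := by nlinarith [sq_nonneg φ]

/-- **Side conditions from the parameter regime**: if `R ≤ |α|^{1/12}/K` (`K ≥ 1`, `R ≥ 1`) and
`|α| ≥ (1 + 138(80β+C₄)(40β+C₃) + (40β+C₃)²)¹²`, then `A′ = 80βR² + C₄`, `B′ = 40βR³ + C₃` satisfy `138A′B′ ≤ |α|`
and `B′² ≤ |α|`. [folklore] -/
theorem coreInverse_params : ∀ (β' C₃ C₄ α R K : ℝ) (hβ : 0 ≤ β') (hC₃ : 0 ≤ C₃) (hC₄ : 0 ≤ C₄) (hK : 1 ≤ K)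
    (hα : (1 + 138 * ((80 * β' + C₄) * (40 * β' + C₃)) + (40 * β' + C₃) ^ 2) ^ 12 ≤ |α|)
    (hR1 : 1 ≤ R) (hR : R ≤ |α| ^ (1 / 12 : ℝ) / K),
    138 * ((80 * β' * R ^ 2 + C₄) * (40 * β' * R ^ 3 + C₃)) ≤ |α| ∧ (40 * β' * R ^ 3 + C₃) ^ 2 ≤ |α| ∧ 0 < |α| := by
  intro β' C₃ C₄ α R K hβ hC₃ hC₄ hK hα hR1 hR
  generalize hq : 1 + 138 * ((80 * β' + C₄) * (40 * β' + C₃)) + (40 * β' + C₃) ^ 2 = q at hα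
  have hpos1 : 0 ≤ 138 * ((80 * β' + C₄) * (40 * β' + C₃)) := by positivity
  have hpos2 : 0 ≤ (40 * β' + C₃) ^ 2 := by positivity
  have hq1 : 1 ≤ q := by rw [← hq]; linarith only [hpos1, hpos2]
  have hq0 : 0 ≤ q := by linarith only [hq1]
  have hq12 : 1 ≤ q ^ 12 := one_le_pow₀ hq1
  have ha1 : 1 ≤ |α| := le_trans hq12 hα
  have ha0 : 0 < |α| := by linarith only [ha1]
  set s : ℝ := |α| ^ (1 / 12 : ℝ) with hs
  have hs0 : 0 ≤ s := Real.rpow_nonneg (abs_nonneg α) _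
  have hs12 : s ^ 12 = |α| := by
    rw [hs, show (1 / 12 : ℝ) = ((12 : ℕ) : ℝ)⁻¹ by norm_num]
    exact Real.rpow_inv_natCast_pow (abs_nonneg α) (by norm_num)
  have hqs : q ≤ s := by
    have : q ^ 12 ≤ s ^ 12 := by rw [hs12]; exact hα
    exact (pow_le_pow_iff_left₀ hq0 hs0 (by norm_num)).1 this
  have hs1 : 1 ≤ s := le_trans hq1 hqs
  have hRs : R ≤ s := by
    calc R ≤ s / K := hR
      _ ≤ s := div_le_self hs0 hK
  have hR0 : 0 ≤ R := by linarith only [hR1]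
  -- `A' ≤ (80β + C₄) s²`, `B' ≤ (40β + C₃) s³`
  have hR2 : R ^ 2 ≤ s ^ 2 := pow_le_pow_left₀ hR0 hRs 2
  have hR3 : R ^ 3 ≤ s ^ 3 := pow_le_pow_left₀ hR0 hRs 3
  have hs2 : 1 ≤ s ^ 2 := one_le_pow₀ hs1
  have hs3 : 1 ≤ s ^ 3 := one_le_pow₀ hs1
  have hA' : 80 * β' * R ^ 2 + C₄ ≤ (80 * β' + C₄) * s ^ 2 := by
    nlinarith only [hβ, hC₄, hR2, hs2, mul_le_mul_of_nonneg_left hR2 hβ]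
  have hB' : 40 * β' * R ^ 3 + C₃ ≤ (40 * β' + C₃) * s ^ 3 := by
    nlinarith only [hβ, hC₃, hR3, hs3, mul_le_mul_of_nonneg_left hR3 hβ]
  have hA'0 : 0 ≤ 80 * β' * R ^ 2 + C₄ := by positivity
  have hB'0 : 0 ≤ 40 * β' * R ^ 3 + C₃ := by positivity
  have hAB : (80 * β' * R ^ 2 + C₄) * (40 * β' * R ^ 3 + C₃) ≤
      ((80 * β' + C₄) * (40 * β' + C₃)) * s ^ 5 := by
    calc (80 * β' * R ^ 2 + C₄) * (40 * β' * R ^ 3 + C₃)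
        ≤ ((80 * β' + C₄) * s ^ 2) * ((40 * β' + C₃) * s ^ 3) :=
          mul_le_mul hA' hB' hB'0 (by positivity)
      _ = ((80 * β' + C₄) * (40 * β' + C₃)) * s ^ 5 := by ring
  have hcoef1 : 138 * ((80 * β' + C₄) * (40 * β' + C₃)) ≤ q := by
    rw [← hq]; linarith only [hpos2]
  have hcoef2 : (40 * β' + C₃) ^ 2 ≤ q := by
    rw [← hq]; linarith only [hpos1]
  have hs6 : s ^ 6 ≤ s ^ 12 := pow_le_pow_right₀ hs1 (by norm_num)
  have hs7 : s ^ 7 ≤ s ^ 12 := pow_le_pow_right₀ hs1 (by norm_num)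
  refine ⟨?_, ?_, ha0⟩
  · calc 138 * ((80 * β' * R ^ 2 + C₄) * (40 * β' * R ^ 3 + C₃))
        ≤ 138 * (((80 * β' + C₄) * (40 * β' + C₃)) * s ^ 5) := by linarith only [hAB]
      _ = (138 * ((80 * β' + C₄) * (40 * β' + C₃))) * s ^ 5 := by ring
      _ ≤ q * s ^ 5 := mul_le_mul_of_nonneg_right hcoef1 (by positivity)
      _ ≤ s * s ^ 5 := mul_le_mul_of_nonneg_right hqs (by positivity)
      _ = s ^ 6 := by ring
      _ ≤ s ^ 12 := hs6
      _ = |α| := hs12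
  · calc (40 * β' * R ^ 3 + C₃) ^ 2 ≤ ((40 * β' + C₃) * s ^ 3) ^ 2 := pow_le_pow_left₀ hB'0 hB' 2
      _ = (40 * β' + C₃) ^ 2 * s ^ 6 := by ring
      _ ≤ q * s ^ 6 := mul_le_mul_of_nonneg_right hcoef2 (by positivity)
      _ ≤ s * s ^ 6 := mul_le_mul_of_nonneg_right hqs (by positivity)
      _ = s ^ 7 := by ring
      _ ≤ s ^ 12 := hs7
      _ = |α| := hs12

end Summit.AnomalousDissipation.AnomalousDissipation.Theorems.MarginalStabilityChainStretchedVortexRows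

end
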